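/-
Copyright (c) 2026 the pub-hodgecm-mathlib formalisation cell (harness21).  Prover seat hodgecm-mathlib-F0P3a-p02 (g18): road «S3-ram», (Cnt2′) ROUTE B (chair F0P3a-p07 (g14);
keeper F0P2-p02 (g14)), organ «J2-POOL» — the pooling step of the type-(2) region census; 2026-09-02.
-/
import Literature.NumberTheory.Rogawski1990.DepthZeroKappaTransferTypeOneRamifiedRootRegionLayers   -- ★ p847622 (this lineage): layers, `card_types_of_branching`, `sum_eq_of_three_types`
import HarnessLib

/-!
# The ramified `κ`-orbital integral: POOLING the per-vertex-type census of a root region with uniform branching (ROUTE B organ «J2-POOL»)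
# (Serre, *Trees* I.2.3; Kottwitz 1986 §3; Rogawski 1990 §4.9)

Topic `NumberTheory/Rogawski1990`; namespace `Literature.NumberTheory.Rogawski1990`.  THEOREMS ONLY (no definition, no instance, no notation, no named fact, no `sorry`);
kernel lane `--supports stmt-HodgeConjecture-24833`; imports ★ `DepthZeroKappaTransferTypeOneRamifiedRootRegionLayers` only — GENERIC rooted-tree bookkeeping, no lattice token.
Cell `pub/hodgecm-mathlib` (D-0151), crux H413; road «S3-ram» (count-neutral); (Cnt2′) ROUTE B: the census binders `(sR.card; hPE hPP hPM)` of the RAW junction heads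
`TypeOneRamifiedJunction.strataCount_J₀_block_raw` ∕ `strataCount_J₀_of_charpoly_block_raw` (keeper F0P2-p02 (g14), deal 2026-09-02T03:34:36Z) and of the even twin
(F0P3a-p04 (g19)), in the J₀-model at `L₀` for the conjugated literal.

THE MATHEMATICS.  In the setting of ★ ENGINE ED. 3 (tree `G`, root `r`, finite parent-closed `F`, alternating `SD`, grandchildren `GC`, region `R ∋ r`, `R ⊆ F`, closed upwards
`hRup`) with UNIFORM REGION BRANCHING — `b₀` region grandchildren at the root, `b` at every region vertex of distance `< 2s`, none beyond `2s` (`hmax`) — the region has three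
vertex TYPES: the ROOT (1 vertex), the INTERIOR vertices (`0 < dist < 2s`; `b₀·Σ_{i<s−1} bⁱ` of them) and the BOUNDARY∕END vertices (`dist = 2s`; `b₀·b^{s−1}` of them);
`#R = 1 + b₀·Σ_{i<s} bⁱ` (★ Layers).  Any per-vertex quantity constant on each type, with values `x₀, x₁, x₂`, therefore sums over the region to
`x₀ + (b₀·Σ_{i<s−1} bⁱ)·x₁ + (b₀·b^{s−1})·x₂` (RAW, factored; no normalisation by `q`).  Type (2) hyperbolic side (the axis ball): `b₀ = 2`, `b = 1`, so `#R = 2s + 1`,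
interior `2(s−1)`, boundary `2`; type (1) isoceles: `b₀ = 2q`, `b = q` (★ `sum_regionTokens_hyperbolic_pool` is that special case with its specific values).  §3: the same
pooling with the three type COUNTS given directly as binders (for censuses that deliver layer sizes rather than branching numbers).
HONEST LABEL: HC_CM is proved only modulo the 2 remaining named inputs (hLiu418 24832, h413 24833) until rung 0 closes; nothing printed is asserted here (bookkeeping).

## References
* [Serre1980Trees] J.-P. Serre, *Trees* (1980), I.2.3 (spheres and balls in a tree; counting by layers).
* [Kottwitz1986] R. E. Kottwitz, *Base change for unit elements of Hecke algebras*, Compositio Math. 60 (1986), §3 (counting fixed lattices shell by shell).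
* [Rogawski1990] J. D. Rogawski, *Automorphic Representations of Unitary Groups in Three Variables*, Ann. of Math. Stud. 123 (1990), §4.9 pp. 54–56.
-/

set_option autoImplicit false

open Finset SimpleGraph
open Literature.Combinatorics.SimpleGraph.TreeLayers

namespace Literature.NumberTheory.Rogawski1990

variable {V : Type*} {G : SimpleGraph V}

/-! ## §1 The three type counts in Finset currency -/

/-- **THE SIZE OF THE REGION (Finset form).**  Under uniform branching `(b₀, b)` up to distance `2s`: `#sR = 1 + b₀·Σ_{i<s} bⁱ`. [cite: Serre1980Trees, I.2.3] [cite: Kottwitz1986, §3] -/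
theorem card_region_of_branching (hT : G.IsTree) (r : V) (F : Set V) (hFfin : F.Finite)
    (hF : ∀ w ∈ F, w ≠ r → ∀ u, G.Adj w u → G.dist r u + 1 = G.dist r w → u ∈ F) (SD : V → Prop)
    (hSD₁ : ∀ v c, G.Adj v c → SD v → ¬ SD c) (hSD₂ : ∀ c w, G.Adj c w → ¬ SD c → SD w) (GC : V → Set V)
    (hGC : ∀ v w, w ∈ GC v ↔ ∃ c, (G.Adj v c ∧ G.dist r c = G.dist r v + 1 ∧ c ∈ F) ∧ (G.Adj c w ∧ G.dist r w = G.dist r c + 1 ∧ w ∈ F))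
    (R : Set V) (hrR : r ∈ R) (hRF : R ⊆ F) (hRS : ∀ v ∈ R, SD v) (hRup : ∀ v ∈ F, SD v → ∀ w ∈ GC v, w ∈ R → v ∈ R)
    (s b₀ b : ℕ) (hroot : {w | w ∈ GC r ∧ w ∈ R}.ncard = b₀)
    (hint : ∀ v ∈ R, v ≠ r → G.dist r v < 2 * s → {w | w ∈ GC v ∧ w ∈ R}.ncard = b)
    (hmax : ∀ v ∈ R, G.dist r v ≤ 2 * s) (sR : Finset V) (hsR : ∀ v, v ∈ sR ↔ v ∈ R) :
    sR.card = 1 + b₀ * ∑ i ∈ range s, b ^ i := by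
  have hset : R = ↑sR := by ext v; rw [Finset.mem_coe, hsR]
  rw [← Set.ncard_coe_finset, ← hset]
  exact ncard_region_eq_of_branching hT r F hFfin hF SD hSD₁ hSD₂ GC hGC R hrR hRF hRS hRup s b₀ b hroot hint hmax

/-- **THE NUMBER OF INTERIOR VERTICES** (`v ≠ r`, `dist r v ≠ 2s`): `b₀·Σ_{i<s−1} bⁱ` (`1 ≤ s`). [cite: Serre1980Trees, I.2.3] [cite: Kottwitz1986, §3] -/
theorem card_interior_of_branching (hT : G.IsTree) (r : V) (F : Set V) (hFfin : F.Finite)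
    (hF : ∀ w ∈ F, w ≠ r → ∀ u, G.Adj w u → G.dist r u + 1 = G.dist r w → u ∈ F) (SD : V → Prop)
    (hSD₁ : ∀ v c, G.Adj v c → SD v → ¬ SD c) (hSD₂ : ∀ c w, G.Adj c w → ¬ SD c → SD w) (GC : V → Set V)
    (hGC : ∀ v w, w ∈ GC v ↔ ∃ c, (G.Adj v c ∧ G.dist r c = G.dist r v + 1 ∧ c ∈ F) ∧ (G.Adj c w ∧ G.dist r w = G.dist r c + 1 ∧ w ∈ F))
    (R : Set V) (hrR : r ∈ R) (hRF : R ⊆ F) (hRS : ∀ v ∈ R, SD v) (hRup : ∀ v ∈ F, SD v → ∀ w ∈ GC v, w ∈ R → v ∈ R)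
    (s b₀ b : ℕ) (hs : 1 ≤ s) (hroot : {w | w ∈ GC r ∧ w ∈ R}.ncard = b₀)
    (hint : ∀ v ∈ R, v ≠ r → G.dist r v < 2 * s → {w | w ∈ GC v ∧ w ∈ R}.ncard = b)
    (hmax : ∀ v ∈ R, G.dist r v ≤ 2 * s) (sR : Finset V) (hsR : ∀ v, v ∈ sR ↔ v ∈ R) [DecidableEq V] :
    (sR.filter fun v => ¬ v = r ∧ ¬ G.dist r v = 2 * s).card = b₀ * ∑ i ∈ range (s - 1), b ^ i := by
  obtain ⟨-, -, htot⟩ := card_types_of_branching hT r F hFfin hF SD hSD₁ hSD₂ GC hGC R hrR hRF hRS hRup s b₀ b hs hroot hint hmax sR hsR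
  obtain ⟨s₀, rfl⟩ : ∃ s₀, s = s₀ + 1 := ⟨s - 1, by omega⟩
  have e1 : s₀ + 1 - 1 = s₀ := Nat.add_sub_cancel s₀ 1
  rw [e1]
  rw [e1, Finset.sum_range_succ, mul_add b₀] at htot
  omega

/-! ## §2 Pooling a type-constant quantity over the region (RAW, factored) -/

/-- **«J2-POOL»: POOLING BY TYPES UNDER UNIFORM BRANCHING.**  If `f` equals `x₀` at the root, `x₁` on the interior vertices and `x₂` on the boundary vertices (`dist = 2s`) of the
region, then `Σ_{v∈sR} f v = x₀ + (b₀·Σ_{i<s−1} bⁱ)·x₁ + (b₀·b^{s−1})·x₂` (apply thrice for the `E`-, `P`-, `M`-token counts of the RAW junction head; type (2) axis ball: `b₀ = 2`,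
`b = 1`). [cite: Kottwitz1986, §3] [cite: Rogawski1990, §4.9 pp. 54–56] -/
theorem sum_region_eq_of_branching_of_types (hT : G.IsTree) (r : V) (F : Set V) (hFfin : F.Finite)
    (hF : ∀ w ∈ F, w ≠ r → ∀ u, G.Adj w u → G.dist r u + 1 = G.dist r w → u ∈ F) (SD : V → Prop)
    (hSD₁ : ∀ v c, G.Adj v c → SD v → ¬ SD c) (hSD₂ : ∀ c w, G.Adj c w → ¬ SD c → SD w) (GC : V → Set V)
    (hGC : ∀ v w, w ∈ GC v ↔ ∃ c, (G.Adj v c ∧ G.dist r c = G.dist r v + 1 ∧ c ∈ F) ∧ (G.Adj c w ∧ G.dist r w = G.dist r c + 1 ∧ w ∈ F))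
    (R : Set V) (hrR : r ∈ R) (hRF : R ⊆ F) (hRS : ∀ v ∈ R, SD v) (hRup : ∀ v ∈ F, SD v → ∀ w ∈ GC v, w ∈ R → v ∈ R)
    (s b₀ b : ℕ) (hs : 1 ≤ s) (hroot : {w | w ∈ GC r ∧ w ∈ R}.ncard = b₀)
    (hint : ∀ v ∈ R, v ≠ r → G.dist r v < 2 * s → {w | w ∈ GC v ∧ w ∈ R}.ncard = b)
    (hmax : ∀ v ∈ R, G.dist r v ≤ 2 * s) (sR : Finset V) (hsR : ∀ v, v ∈ sR ↔ v ∈ R) [DecidableEq V]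
    (f : V → ℕ) (x₀ x₁ x₂ : ℕ) (h₀ : ∀ v ∈ sR, v = r → f v = x₀) (h₁ : ∀ v ∈ sR, ¬ v = r → ¬ G.dist r v = 2 * s → f v = x₁)
    (h₂ : ∀ v ∈ sR, ¬ v = r → G.dist r v = 2 * s → f v = x₂) :
    ∑ v ∈ sR, f v = x₀ + (b₀ * ∑ i ∈ range (s - 1), b ^ i) * x₁ + (b₀ * b ^ (s - 1)) * x₂ := by
  obtain ⟨h1, hend, -⟩ := card_types_of_branching hT r F hFfin hF SD hSD₁ hSD₂ GC hGC R hrR hRF hRS hRup s b₀ b hs hroot hint hmax sR hsR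
  have hmid := card_interior_of_branching hT r F hFfin hF SD hSD₁ hSD₂ GC hGC R hrR hRF hRS hRup s b₀ b hs hroot hint hmax sR hsR
  rw [sum_eq_of_three_types sR (fun v => v = r) (fun v => G.dist r v = 2 * s) f x₀ x₁ x₂ h₀ h₁ h₂, h1, hmid, hend, smul_eq_mul, smul_eq_mul, smul_eq_mul, one_mul]

/-! ## §3 The same pooling from the three type COUNTS (no branching input) -/

/-- **POOLING BY TYPES FROM THE TYPE COUNTS.**  For any Finset `sR`, predicates `P₀` (root type) and `P₂` (boundary type) and a quantity `f` with values `x₀ ∕ x₁ ∕ x₂` on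
`P₀` ∕ `¬P₀ ∧ ¬P₂` ∕ `¬P₀ ∧ P₂`: if the three types number `n₀, n₁, n₂` then `#sR = n₀ + n₁ + n₂` and `Σ_{v∈sR} f v = n₀·x₀ + n₁·x₁ + n₂·x₂`. [cite: Kottwitz1986, §3]
[cite: Rogawski1990, §4.9 pp. 54–56] -/
theorem card_and_sum_eq_of_typeCounts (sR : Finset V) (P₀ P₂ : V → Prop) [DecidablePred P₀] [DecidablePred P₂] (n₀ n₁ n₂ : ℕ)
    (hn₀ : (sR.filter fun v => P₀ v).card = n₀) (hn₁ : (sR.filter fun v => ¬ P₀ v ∧ ¬ P₂ v).card = n₁) (hn₂ : (sR.filter fun v => ¬ P₀ v ∧ P₂ v).card = n₂)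
    (f : V → ℕ) (x₀ x₁ x₂ : ℕ) (h₀ : ∀ v ∈ sR, P₀ v → f v = x₀) (h₁ : ∀ v ∈ sR, ¬ P₀ v → ¬ P₂ v → f v = x₁) (h₂ : ∀ v ∈ sR, ¬ P₀ v → P₂ v → f v = x₂) :
    sR.card = n₀ + n₁ + n₂ ∧ ∑ v ∈ sR, f v = n₀ * x₀ + n₁ * x₁ + n₂ * x₂ := by
  classical
  refine ⟨?_, ?_⟩
  · rw [← Finset.card_filter_add_card_filter_not (s := sR) (fun v => P₀ v), hn₀,
      ← Finset.card_filter_add_card_filter_not (s := sR.filter fun v => ¬ P₀ v) (fun v => P₂ v), Finset.filter_filter, Finset.filter_filter, hn₂]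
    have h1' : (sR.filter fun v => ¬ P₀ v ∧ ¬ P₂ v).card = n₁ := hn₁
    rw [h1']
    ring
  · rw [sum_eq_of_three_types sR P₀ P₂ f x₀ x₁ x₂ h₀ h₁ h₂, hn₀, hn₁, hn₂, smul_eq_mul, smul_eq_mul, smul_eq_mul]

end Literature.NumberTheory.Rogawski1990
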